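import Summits.PneNP.PneNP.Theorems.SingleThreshold.Negative.LoadBearing

/-!
# `SingleThreshold` (stmt-PneNP-2833) — negative-side lemmas III: the critical density is load-bearing

* §5 `not_lowerBound_of_subcritical`, `not_singleThresholdSubcritical` — at any density `q_n → 0`
  with first moment `C(n,k) q_n^{C(k,2)} → 0` (e.g. Rossman 2008's `n^{-2/(k-2)}`) the statement is
  FALSE for every `k` (the size-0 circuit `x_e` is eventually `δ`-accurate).
* §6 `gnpProb_forall_not_allOn` — independence over pairwise disjoint edge sets in inclusion–exclusion
  form: `Pr[no S_i fully present in G(n,p)] = ∏ (1 - p^{|S_i|})`; `gnpProb_cliqueFree_le_pow` —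
  `Pr[ω_k(G(n,p)) = 0] ≤ (1 - p^{C(k,2)})^{⌊n/k⌋}` (disjoint blocks); `not_singleThresholdDense` — at
  constant density `p = 1/2` the statement is FALSE for every `k` ("G has an edge", ≤ C(n,2) < n²
  gates). With §5: any proof must use the CRITICAL scaling `p_c = n^{-2/(k-1)}` on both sides.
Refuter seat cdisprove-stmt-PneNP-2833 (gen 1), 2026-08-16.
-/

namespace Summit.PneNP.PneNP.Theorems.SingleThreshold.Negative

open Literature.Computability.Complexity Finset Filter Classical
open Summit.PneNP.PneNP.Theses.OneSlice (SingleThreshold)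

noncomputable section

/-! ## §5 The critical density is load-bearing (subcritical side) -/

/-- Error of `C` for `k`-CLIQUE at a general density `q`. [folklore] -/
def errAt (n k : ℕ) (q : ℝ) (C : Circuit (Edges n)) : ℝ :=
  gnpProb n q (univ.filter fun x => C.eval x ≠ cliqueFn n k x)

/-- **Subcritical densities kill the lower bound.** If `q_n → 0` and the first moment
`C(n,k) q_n^{C(k,2)} → 0`, then at density `q_n` NO `δ > 0` and exponent `c` give the lower
bound: the size-0 circuit `x_e` is eventually `δ`-accurate. So any proof of the crux must use that
`p_c = n^{-2/(k-1)}` keeps `E[ω_k]` bounded AWAY FROM `0`. [folklore] -/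
theorem not_lowerBound_of_subcritical {k : ℕ} {q : ℕ → ℝ} (hq : ∀ n, 0 ≤ q n ∧ q n ≤ 1)
    (h0 : Tendsto q atTop (nhds 0))
    (h1 : Tendsto (fun n => (n.choose k : ℝ) * q n ^ (k.choose 2)) atTop (nhds 0))
    {δ : ℝ} (hδ : 0 < δ) (c : ℕ) :
    ¬ ∀ᶠ n : ℕ in atTop, ∀ C : Circuit (Edges n), C.IsOver monotoneBasis →
      errAt n k (q n) C ≤ δ → n ^ c < C.size := by
  intro h
  have hsum : Tendsto (fun n => q n + (n.choose k : ℝ) * q n ^ (k.choose 2)) atTop (nhds 0) := by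
    simpa using h0.add h1
  obtain ⟨n, hn, hle, hn2⟩ :=
    (h.and ((hsum.eventually (eventually_le_nhds hδ)).and (eventually_ge_atTop 2))).exists
  have herr : errAt n k (q n) (Circuit.input (e01 n hn2)) ≤ δ :=
    (err_input_le (e01 n hn2) (hq n).1 (hq n).2).trans hle
  have := hn (Circuit.input (e01 n hn2)) (fun g hg => by simp [Circuit.input] at hg) herr
  simp at this

/-- **Below the threshold the statement is FALSE** (the crux transplanted to Rossman's 2008
subcritical density `n^{-2/(k-2)}`; every `k ≥ 3`): cliques vanish a.a.s. (first moment,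
`tendsto_choose_mul_rpow_subcritical`) and `x_e` is `δ`-accurate. [folklore] -/
theorem not_singleThresholdSubcritical :
    ¬ ∀ c : ℕ, ∃ k : ℕ, 3 ≤ k ∧ ∃ δ : ℝ, 0 < δ ∧ ∀ᶠ n : ℕ in atTop,
      ∀ C : Circuit (Edges n), C.IsOver monotoneBasis →
        errAt n k ((n : ℝ) ^ (-(2 / ((k : ℝ) - 2)))) C ≤ δ → n ^ c < C.size := by
  intro h
  obtain ⟨k, hk3, δ, hδ, hev⟩ := h 0
  have hk2 : (0 : ℝ) < 2 / ((k : ℝ) - 2) := by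
    have : (3 : ℝ) ≤ k := by exact_mod_cast hk3
    exact div_pos two_pos (by linarith)
  refine not_lowerBound_of_subcritical (k := k) (q := fun n => (n : ℝ) ^ (-(2 / ((k : ℝ) - 2))))
    (fun n => ⟨Real.rpow_nonneg (Nat.cast_nonneg n) _, ?_⟩) ?_
    (tendsto_choose_mul_rpow_subcritical hk3) hδ 0 hev
  · rcases Nat.eq_zero_or_pos n with rfl | hn
    · simp [Real.zero_rpow (neg_ne_zero.2 hk2.ne')]
    · exact Real.rpow_le_one_of_one_le_of_nonpos (by exact_mod_cast hn) (neg_nonpos.2 hk2.le)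
  · exact ((tendsto_rpow_neg_atTop hk2).comp tendsto_natCast_atTop_atTop).congr fun n => rfl

/-! ## §6 The critical density is load-bearing (supercritical / dense side) -/

/-! ### §6.1 Independence over disjoint edge sets -/

/-- **Independence across pairwise disjoint edge sets** (inclusion–exclusion form): for pairwise
disjoint edge sets `S i`, `Pr[no S_i is fully present in G(n,p)] = ∏ᵢ (1 - p^{|S_i|})`. [folklore] -/
theorem gnpProb_forall_not_allOn {ι : Type*} {n : ℕ} (T : Finset ι) (S : ι → Finset (Edges n))
    (hS : (T : Set ι).PairwiseDisjoint S) (p : ℝ) :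
    gnpProb n p (univ.filter fun x : Edges n → Bool => ∀ i ∈ T, ¬ ∀ e ∈ S i, x e = true) =
      ∏ i ∈ T, (1 - p ^ #(S i)) := by
  classical
  -- pointwise inclusion–exclusion
  have hpt : ∀ x : Edges n → Bool,
      (if (∀ i ∈ T, ¬ ∀ e ∈ S i, x e = true) then (1 : ℝ) else 0) =
        ∑ J ∈ T.powerset, (-1 : ℝ) ^ #J * (if (∀ i ∈ J, ∀ e ∈ S i, x e = true) then 1 else 0) := by
    intro x
    have h1 : (if (∀ i ∈ T, ¬ ∀ e ∈ S i, x e = true) then (1 : ℝ) else 0) =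
        ∏ i ∈ T, (-(if (∀ e ∈ S i, x e = true) then (1 : ℝ) else 0) + 1) := by
      rw [← Finset.prod_boole]
      refine Finset.prod_congr rfl fun i _ => ?_
      split_ifs <;> norm_num
    rw [h1, Finset.prod_add]
    refine Finset.sum_congr rfl fun J hJ => ?_
    rw [prod_const_one, mul_one, Finset.prod_neg, Finset.prod_boole]
  -- integrate
  rw [gnpProb_filter]
  have h2 : ∀ x : Edges n → Bool, (if (∀ i ∈ T, ¬ ∀ e ∈ S i, x e = true) then gnpWeight n p x else 0)
      = ∑ J ∈ T.powerset, (-1 : ℝ) ^ #J *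
          (if (∀ i ∈ J, ∀ e ∈ S i, x e = true) then gnpWeight n p x else 0) := by
    intro x
    have := congrArg (fun r => r * gnpWeight n p x) (hpt x)
    simp only [ite_mul, one_mul, zero_mul, Finset.sum_mul] at this
    rw [this]
    refine Finset.sum_congr rfl fun J _ => ?_
    split_ifs <;> ring
  simp_rw [h2]
  rw [Finset.sum_comm]
  -- each inner sum is a marginal
  have h3 : ∀ J ∈ T.powerset,
      ∑ x : Edges n → Bool, (-1 : ℝ) ^ #J *
          (if (∀ i ∈ J, ∀ e ∈ S i, x e = true) then gnpWeight n p x else 0) =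
        ∏ i ∈ J, (-(p ^ #(S i))) := by
    intro J hJ
    have hJT : J ⊆ T := Finset.mem_powerset.1 hJ
    rw [← Finset.mul_sum, ← Finset.sum_filter]
    have hset : (univ.filter fun x : Edges n → Bool => ∀ i ∈ J, ∀ e ∈ S i, x e = true) =
        (univ.filter fun x : Edges n → Bool => ∀ e ∈ J.biUnion S, x e = true) := by
      ext x
      simp only [mem_filter, mem_univ, true_and, mem_biUnion, forall_exists_index, and_imp]
      constructor
      · intro h e i hi he
        exact h i hi e he
      · intro h i hi e he
        exact h e i hi he
    rw [hset, sum_gnpWeight_filter_forall, Finset.card_biUnion (hS.subset hJT),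
      Finset.prod_neg, ← Finset.prod_pow_eq_pow_sum]
  rw [Finset.sum_congr rfl h3]
  -- and back to a product
  have h4 := Finset.prod_add (fun i => -(p ^ #(S i))) (fun _ => (1 : ℝ)) T
  simp only [prod_const_one, mul_one] at h4
  rw [← h4]
  exact Finset.prod_congr rfl fun i _ => by ring

/-! ### §6.2 Vertex-disjoint blocks of `k` consecutive vertices -/

/-- The `i`-th block of `k` consecutive vertices `{ik, …, ik + k - 1}` of `Fin n`, `i < n / k`,
as an embedding. [folklore] -/
def blockEmb (n k : ℕ) (i : Fin (n / k)) : Fin k ↪ Fin n :=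
  ⟨fun j => ⟨(i : ℕ) * k + j, by
      have hi : ((i : ℕ) + 1) * k ≤ n / k * k := Nat.mul_le_mul_right k i.2
      have hn : n / k * k ≤ n := Nat.div_mul_le_self n k
      have hj := j.2
      have h3 : ((i : ℕ) + 1) * k = (i : ℕ) * k + k := by ring
      omega⟩,
    fun a b hab => by
      simp only [Fin.mk.injEq] at hab
      exact Fin.ext (by omega)⟩

/-- The `i`-th block as a vertex set. [folklore] -/
def block (n k : ℕ) (i : Fin (n / k)) : Finset (Fin n) := univ.map (blockEmb n k i)

/-- Block bookkeeping. [folklore] -/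
theorem card_block (n k : ℕ) (i : Fin (n / k)) : #(block n k i) = k := by
  rw [block, card_map, card_univ, Fintype.card_fin]

/-- Block bookkeeping. [folklore] -/
theorem mem_block_iff {n k : ℕ} (i : Fin (n / k)) (v : Fin n) :
    v ∈ block n k i ↔ ∃ j : Fin k, (i : ℕ) * k + j = v := by
  simp only [block, Finset.mem_map, mem_univ, true_and]
  constructor
  · rintro ⟨j, hj⟩
    refine ⟨j, ?_⟩
    rw [← hj]
    rfl
  · rintro ⟨j, hj⟩
    exact ⟨j, Fin.ext hj⟩

/-- Block bookkeeping. [folklore] -/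
theorem block_disjoint {n k : ℕ} (hk : 0 < k) {i j : Fin (n / k)} (hij : i ≠ j) :
    Disjoint (block n k i) (block n k j) := by
  rw [Finset.disjoint_left]
  intro v hvi hvj
  rw [mem_block_iff] at hvi hvj
  obtain ⟨a, ha⟩ := hvi
  obtain ⟨b, hb⟩ := hvj
  have h1 : ((i : ℕ) * k + a) / k = i := by
    rw [Nat.add_comm, Nat.add_mul_div_right _ _ hk, Nat.div_eq_of_lt a.2, zero_add]
  have h2 : ((j : ℕ) * k + b) / k = j := by
    rw [Nat.add_comm, Nat.add_mul_div_right _ _ hk, Nat.div_eq_of_lt b.2, zero_add]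
  have : (i : ℕ) = j := by rw [← h1, ← h2, ha, hb]
  exact hij (Fin.ext this)

/-- The edges inside the `i`-th block. [folklore] -/
def blockEdges (n k : ℕ) (i : Fin (n / k)) : Finset (Edges n) :=
  univ.filter fun e => cliqueVec (block n k i) e = true

/-- Block bookkeeping. [folklore] -/
theorem card_blockEdges (n k : ℕ) (i : Fin (n / k)) : #(blockEdges n k i) = k.choose 2 := by
  rw [blockEdges, card_filter_cliqueVec, card_block]

/-- Block bookkeeping. [folklore] -/
theorem blockEdges_pairwiseDisjoint {n k : ℕ} (hk : 0 < k) :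
    ((univ : Finset (Fin (n / k))) : Set (Fin (n / k))).PairwiseDisjoint (blockEdges n k) := by
  intro i _ j _ hij
  simp only [Function.onFun]
  rw [Finset.disjoint_left]
  intro e hei hej
  simp only [blockEdges, mem_filter, mem_univ, true_and, cliqueVec, decide_eq_true_eq] at hei hej
  obtain ⟨e, he⟩ := e
  induction e using Sym2.ind with
  | h u v =>
    have hu1 : u ∈ block n k i := hei u (Sym2.mem_mk_left u v)
    have hu2 : u ∈ block n k j := hej u (Sym2.mem_mk_left u v)
    exact Finset.disjoint_left.1 (block_disjoint hk hij) hu1 hu2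

/-- **Disjoint blocks**: `Pr[ω_k(G(n,p)) = 0] ≤ (1 - p^{C(k,2)})^{⌊n/k⌋}`. [folklore] -/
theorem gnpProb_cliqueFree_le_pow {n k : ℕ} (hk : 0 < k) {p : ℝ} (hp0 : 0 ≤ p) (hp1 : p ≤ 1) :
    gnpProb n p (univ.filter fun x => cliqueFn n k x = false) ≤ (1 - p ^ k.choose 2) ^ (n / k) := by
  have hsub : (univ.filter fun x : Edges n → Bool => cliqueFn n k x = false) ⊆
      univ.filter fun x => ∀ i ∈ (univ : Finset (Fin (n / k))), ¬ ∀ e ∈ blockEdges n k i, x e = true := by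
    intro x hx
    simp only [mem_filter, mem_univ, true_and] at hx
    refine mem_filter.2 ⟨mem_univ _, fun i _ hall => ?_⟩
    have : cliqueFn n k x = true := by
      rw [cliqueFn_eq_true_iff_exists]
      refine ⟨block n k i, card_block n k i, fun e he => hall e ?_⟩
      simp only [blockEdges, mem_filter, mem_univ, true_and]
      exact (cliqueVec_eq_true_iff _ _).2 he
    rw [hx] at this
    exact absurd this (by decide)
  calc gnpProb n p (univ.filter fun x => cliqueFn n k x = false)
      ≤ gnpProb n p (univ.filter fun x =>
          ∀ i ∈ (univ : Finset (Fin (n / k))), ¬ ∀ e ∈ blockEdges n k i, x e = true) :=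
        gnpProb_mono hp0 hp1 hsub
    _ = ∏ i ∈ (univ : Finset (Fin (n / k))), (1 - p ^ #(blockEdges n k i)) := by
        have h := gnpProb_forall_not_allOn (univ : Finset (Fin (n / k))) (blockEdges n k)
          (blockEdges_pairwiseDisjoint hk) p
        convert h using 3
    _ = (1 - p ^ k.choose 2) ^ (n / k) := by
        simp only [card_blockEdges, prod_const, card_univ, Fintype.card_fin]

/-! ### §6.3 The dense regime `p = 1/2` -/

/-- **The OR of all edges** ("`G` has an edge"): a `{∧₂,∨₂}`-circuit of size `≤ C(n,2)`. [folklore] -/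
theorem exists_orAll_circuit {n : ℕ} (hn : 2 ≤ n) :
    ∃ C : Circuit (Edges n), C.IsOver monotoneBasis ∧ C.size ≤ n.choose 2 ∧
      ∀ x, C.eval x = decide (∃ e, x e = true) := by
  classical
  have hne : (univ : Finset (Edges n)).toList ≠ [] := by
    intro hnil
    have h01 : s((⟨0, by omega⟩ : Fin n), ⟨1, by omega⟩) ∈ (⊤ : SimpleGraph (Fin n)).edgeSet := by
      rw [SimpleGraph.mem_edgeSet, SimpleGraph.top_adj]; simp
    have := Finset.mem_toList.2 (mem_univ (⟨_, h01⟩ : Edges n))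
    rw [hnil] at this
    simp at this
  obtain ⟨C, hCB, hsize, hCev⟩ := (cktSize_any (univ : Finset (Edges n)).toList hne).toCircuit
  refine ⟨C, hCB, ?_, fun x => ?_⟩
  · rw [Finset.length_toList, card_univ, card_edgeSet_top_fin] at hsize
    exact hsize
  · rw [hCev]
    apply Bool.eq_iff_iff.2
    simp [List.any_eq_true]

/-- `Pr[G(n,p) has no edge] = (1-p)^{C(n,2)}`. [folklore] -/
theorem gnpProb_noEdge (n : ℕ) (p : ℝ) :
    gnpProb n p (univ.filter fun x : Edges n → Bool => ¬ ∃ e, x e = true) = (1 - p) ^ n.choose 2 := by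
  have hset : (univ.filter fun x : Edges n → Bool => ¬ ∃ e, x e = true) = {fun _ => false} := by
    ext x
    simp only [mem_filter, mem_univ, true_and, mem_singleton, not_exists, Bool.not_eq_true]
    constructor
    · intro h; funext e; exact h e
    · intro h e; rw [h]
  rw [hset, gnpProb, sum_singleton, gnpWeight, edgeCount]
  simp

/-- **At constant density the statement is FALSE** (supercritical side; every `k ≥ 1`):
on `G(n, 1/2)` the size-`≤ C(n,2)` circuit "`G` has an edge" errs w.p.
`≤ 2^{-C(n,2)} + (1 - 2^{-C(k,2)})^{⌊n/k⌋} → 0`, so no `δ > 0` enforces more than `n²` gates.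
Together with the subcritical side: any proof of the crux must use the CRITICAL scaling of `p`.
[folklore] -/
theorem not_singleThresholdDense :
    ¬ ∀ c : ℕ, ∃ k : ℕ, 3 ≤ k ∧ ∃ δ : ℝ, 0 < δ ∧ ∀ᶠ n : ℕ in atTop,
      ∀ C : Circuit (Edges n), C.IsOver monotoneBasis →
        errAt n k (1 / 2) C ≤ δ → n ^ c < C.size := by
  intro h
  obtain ⟨k, hk3, δ, hδ, hev⟩ := h 2
  have hk : 0 < k := by omega
  -- both error terms tend to `0`
  have hA : Tendsto (fun n : ℕ => (1 - (1 / 2 : ℝ)) ^ n.choose 2) atTop (nhds 0) := by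
    have h1 : Tendsto (fun m : ℕ => (1 - (1 / 2 : ℝ)) ^ m) atTop (nhds 0) :=
      tendsto_pow_atTop_nhds_zero_of_lt_one (by norm_num) (by norm_num)
    refine h1.comp ?_
    refine tendsto_atTop_atTop.2 fun b => ⟨b + 2, fun n hn => ?_⟩
    calc b ≤ n - 1 := by omega
      _ ≤ n.choose 2 := by
          rw [Nat.choose_two_right]
          rcases n with _ | n
          · simp
          · simp only [Nat.succ_sub_one]
            calc n = n * 2 / 2 := by omega
              _ ≤ (n + 1) * n / 2 := Nat.div_le_div_right (by nlinarith)
  have hB : Tendsto (fun n : ℕ => (1 - (1 / 2 : ℝ) ^ k.choose 2) ^ (n / k)) atTop (nhds 0) := by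
    have hq1 : (1 - (1 / 2 : ℝ) ^ k.choose 2) < 1 := by
      have : (0 : ℝ) < (1 / 2 : ℝ) ^ k.choose 2 := by positivity
      linarith
    have hq0 : 0 ≤ (1 - (1 / 2 : ℝ) ^ k.choose 2) := by
      have : (1 / 2 : ℝ) ^ k.choose 2 ≤ 1 := pow_le_one₀ (by norm_num) (by norm_num)
      linarith
    have h1 := tendsto_pow_atTop_nhds_zero_of_lt_one hq0 hq1
    refine h1.comp ?_
    exact tendsto_atTop_atTop.2 fun b => ⟨b * k, fun n hn => (Nat.le_div_iff_mul_le hk).2 hn⟩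
  have hsum : Tendsto (fun n : ℕ => (1 - (1 / 2 : ℝ)) ^ n.choose 2 +
      (1 - (1 / 2 : ℝ) ^ k.choose 2) ^ (n / k)) atTop (nhds 0) := by
    simpa using hA.add hB
  obtain ⟨n, hn, hle, hn2⟩ :=
    (hev.and ((hsum.eventually (eventually_le_nhds hδ)).and (eventually_ge_atTop 2))).exists
  obtain ⟨C, hCB, hsize, hCev⟩ := exists_orAll_circuit hn2
  -- the error of `C`
  have herr : errAt n k (1 / 2) C ≤ δ := by
    have hsub : (univ.filter fun x : Edges n → Bool => C.eval x ≠ cliqueFn n k x) ⊆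
        (univ.filter fun x : Edges n → Bool => ¬ ∃ e, x e = true) ∪
          (univ.filter fun x => cliqueFn n k x = false) := by
      intro x hx
      simp only [mem_filter, mem_univ, true_and, hCev] at hx
      simp only [mem_union, mem_filter, mem_univ, true_and]
      by_cases hex : ∃ e, x e = true
      · right
        rw [decide_eq_true hex] at hx
        revert hx
        cases cliqueFn n k x <;> simp
      · exact Or.inl hex
    have h12 : (0 : ℝ) ≤ 1 / 2 := by norm_num
    have h12' : (1 / 2 : ℝ) ≤ 1 := by norm_num
    calc errAt n k (1 / 2) C ≤ gnpProb n (1 / 2) ((univ.filter fun x : Edges n → Bool => ¬ ∃ e, x e = true) ∪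
          (univ.filter fun x => cliqueFn n k x = false)) := gnpProb_mono h12 h12' hsub
      _ ≤ gnpProb n (1 / 2) (univ.filter fun x : Edges n → Bool => ¬ ∃ e, x e = true) +
          gnpProb n (1 / 2) (univ.filter fun x => cliqueFn n k x = false) := by
          have hh := Finset.sum_union_inter
            (s₁ := (univ.filter fun x : Edges n → Bool => ¬ ∃ e, x e = true))
            (s₂ := (univ.filter fun x => cliqueFn n k x = false)) (f := gnpWeight n (1 / 2))
          have h0 : 0 ≤ gnpProb n (1 / 2) ((univ.filter fun x : Edges n → Bool => ¬ ∃ e, x e = true) ∩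
            (univ.filter fun x => cliqueFn n k x = false)) := gnpProb_nonneg h12 h12' _
          unfold gnpProb at *
          linarith
      _ ≤ (1 - (1 / 2 : ℝ)) ^ n.choose 2 + (1 - (1 / 2 : ℝ) ^ k.choose 2) ^ (n / k) := by
          rw [gnpProb_noEdge]
          exact add_le_add le_rfl (gnpProb_cliqueFree_le_pow hk h12 h12')
      _ ≤ δ := hle
  have h1 := hn C hCB herr
  have h2 : n.choose 2 < n ^ 2 := by
    have ha : n.choose 2 ≤ n * (n - 1) := by
      rw [Nat.choose_two_right]; exact Nat.div_le_self _ _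
    have hb : n * (n - 1) = n * n - n := Nat.mul_sub_one n n
    have hc : n ≤ n * n := Nat.le_mul_self n
    have hd : n ^ 2 = n * n := sq n
    omega
  omega


end

end Summit.PneNP.PneNP.Theorems.SingleThreshold.Negative
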